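import Summits.ABC.IUTFork.Joshi.TestFundamentalEstimate
import Summits.ABC.IUTFork.Joshi.TestHarness
import HarnessLib

/-!
# Branch E — Joshi's (9.9.4) reading J against the block's TEST HARNESS shapes, and the §L2 attach point typed

Record file of the abc-iut cell, branch E (rung LADDER-ABC:A2.E; seat abc-iut-E-t4; relation lemmas between p428059's J :=
`Joshi.ThetaValuationScaling P ∧ Joshi.QLocalNonpos P` ([J-III] arXiv:2401.13508 (9.9.4), p0121.txt l.37–66, read on the frozen
`Cor312.Setting`) and abc-iut-E-cx's harness shapes `Joshi.SubsetVolumeBound` (SVB), `Joshi.HullVolumeDominance` (HVD), `Joshi.ThetaBelowQ`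
(`Joshi/TestHarness.lean`, p428758), for cx/TEST-LEDGER.md and plan/E/E-LOCATION.md §L2 («where is the q-parameter pinned?»). **No side is
taken** on [IUTchIII] Cor. 3.12 or on any author; typed ≠ proved ≠ endorsed; every reading predicate is a hypothesis BY NAME.

RESULTS (kernel, model-free — for EVERY setting `P`):
* `subsetVolumeBound_of_scaling` / `hullVolumeDominance_of_scaling`: J ⟹ SVB (given `ThetaRegionsAdm`) ⟹ HVD (given `BridgeHyps`) — J sits
  at the TOP of the harness's volume lattice `VT ⟹ SVB ⟺ HVD ⟹ Statement` (it implies VT, p428059).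
* `not_scaling_of_thetaBelowQ`: E-cx's dual obstruction `ThetaBelowQ` kills J (with `QLocalNonpos`) — the general form of p428059's
  `not_scaling_pinnedSetting` (there `thetaBelowQ_pinnedSetting`).
* **THE §L2 ATTACH POINT AS A PAIR OF TYPED PREDICATES**: `ThetaSquareLaw P` := «in every packet at label `j` every Kummer image of the Θ-pilot
  has log-volume `j²` times the q-pilot contribution» — the MOCHIZUKI-normalised size law of the Θ-pilot (`q̲_v^{j²}` vs `q̲_v`: [IUTchIII] Def.
  3.8 (i) / Prop. 3.5 generators; Dupuy–Hilado's `P_{Θ,j} = j²·P_q`, the tree's PROVED `Literature.IUT.LogVolume.PilotDivisors.deg_thetaPilot`;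
  the cell's pinned model: `thetaRegion m j = B_{j²}`, q-image `B_1`) read on regions exactly as J reads (9.9.4). THEN:
  `thetaBelowQ_of_thetaSquareLaw` (ℓ* ≥ 2 and `qLocal < 0` in some packet at label 2 ⟹ `ThetaBelowQ`), hence
  **`not_scaling_of_thetaSquareLaw`**: J ∧ `ThetaSquareLaw` is UNSATISFIABLE on any setting with `ℓ* ≥ 2` and a packet at label 2 where
  `qLocal < 0` — and dually `not_thetaSquareLaw_of_scaling`. The two readings differ by WHERE the q-parameter is pinned (Joshi: at the
  last label `ℓ*`, exponents `(j/ℓ*)² ≤ 1`; [IUTchIII] as typed by the cell: at exponent `1` below all `j² ≥ 1`) — LOCATED, not adjudicated.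
[claim: Joshi2024ATS3, status: disputed] [claim: Mochizuki2012, status: disputed] [cite: DupuyHilado2025, §3.3]
-/

noncomputable section

open Set

namespace Summit.ABC.IUTFork.Joshi

open Thm311 Cor312 Cor312Vol Literature.IUT.LogThetaLattice

variable {T : ThetaIndex} {S : Situation T} {P : Cor312.Setting S}

/-! ## 1. J in the harness lattice -/

/-- **J ⟹ SVB** (given admissible Kummer images): Joshi's reading exhibits, in every packet, ONE admissible subset of the hull — a Kummer image
of the Θ-pilot — of log-volume ≥ the q-pilot contribution (E-cx's shape for [J-III] Thm 9.11.1, p0127.txt l.41–55). [claim: Joshi2024ATS3, status: disputed] -/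
theorem subsetVolumeBound_of_scaling (hadm : ThetaRegionsAdm P) (hJ : ThetaValuationScaling P) (hq : QLocalNonpos P) :
    SubsetVolumeBound P :=
  subsetVolumeBound_of_volumeTransport hadm (volumeTransport_of_scaling hJ hq)

/-- **J ⟹ HVD** under the bridge hypotheses. [claim: Joshi2024ATS3, status: disputed] -/
theorem hullVolumeDominance_of_scaling (H : BridgeHyps P) (hadm : ThetaRegionsAdm P) (hJ : ThetaValuationScaling P)
    (hq : QLocalNonpos P) : HullVolumeDominance P :=
  hullVolumeDominance_of_subsetVolumeBound H (subsetVolumeBound_of_scaling hadm hJ hq)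

/-- **`ThetaBelowQ` kills J**: if in some packet every Kummer image of the Θ-pilot is strictly smaller (in log-volume) than the q-pilot
contribution, Joshi's (9.9.4)-reading cannot hold there (general form of p428059's `not_scaling_pinnedSetting`). [folklore] -/
theorem not_scaling_of_thetaBelowQ (h : ThetaBelowQ P) (hq : QLocalNonpos P) : ¬ ThetaValuationScaling P := fun hJ =>
  not_volumeTransport_of_thetaBelowQ h (volumeTransport_of_scaling hJ hq)

/-! ## 2. The §L2 attach point: Joshi's `(j/ℓ*)²` law vs the `j²` law, both read on regions -/

variable (P) in
/-- **`ThetaSquareLaw` — the MOCHIZUKI-normalised size law of the Θ-pilot read on regions** (the counterpart of `ThetaValuationScaling`):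
in every packet at label `j = i+1` EVERY Kummer image of the Θ-pilot object has log-volume `j²` times the q-pilot contribution — `q̲_v^{j²}`
against `q̲_v` ([IUTchIII] Def. 3.8 (i), Prop. 3.5 (ii): the Θ-pilot is formed from the theta values `q̲_v^{j²}`, the q-pilot from `q̲_v`;
Dupuy–Hilado §3.3 `P_{Θ,j} = Σ_v ord_v(q̲_v^{j²})[v]`, the tree's `PilotDivisors.deg_thetaPilot : deg P_{Θ,j} = j²·deg P_q`; the cell's
object-honest pinned model has `thetaRegion m j = B_{j²}`, q-image `B_1`). READING PREDICATE, never asserted.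
[claim: Mochizuki2012, status: disputed] [cite: DupuyHilado2025, §3.3] -/
@[claim "Mochizuki2012" "disputed"]
def ThetaSquareLaw : Prop :=
  ∀ (i : Fin T.lstar) (vQ : T.VQ) (m : ℤ),
    (S.D P.n).logvol (Setting.labelSucc i) vQ (P.thetaRegion m (Setting.labelSucc i) vQ) =
      ((((i : ℕ) : ℝ) + 1) ^ 2) * P.qLocal (Setting.labelSucc i) vQ

/-- The index `i = 1` of the label `j = 2 ∈ 𝔽_l^⋇` (it exists since `ℓ* ≥ 2`, `ThetaIndex.two_le_lstar`). [folklore] -/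
def idxTwo (T : ThetaIndex) : Fin T.lstar := ⟨1, lt_of_lt_of_le one_lt_two T.two_le_lstar⟩

/-- **`ThetaSquareLaw` ⟹ E-cx's `ThetaBelowQ`** as soon as the q-pilot contribution is NEGATIVE in some packet at label `2`: there every
Kummer image has log-volume `4·qLocal < qLocal`. [folklore] -/
theorem thetaBelowQ_of_thetaSquareLaw (hM : ThetaSquareLaw P) {vQ : T.VQ} (hq : P.qLocal (Setting.labelSucc (idxTwo T)) vQ < 0) :
    ThetaBelowQ P := by
  refine ⟨idxTwo T, vQ, fun m => ?_⟩
  rw [hM (idxTwo T) vQ m]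
  have h4 : ((((idxTwo T : Fin T.lstar) : ℕ) : ℝ) + 1) ^ 2 = 4 := by
    unfold idxTwo
    norm_num
  rw [h4]
  linarith

/-- **`not_scaling_of_thetaSquareLaw` — THE §L2 ATTACH POINT, TYPED**: on any setting with a packet at label `2` where the q-pilot contribution
is negative (`|log q| > 0` there), the `j²` law and Joshi's `(j/ℓ*)²` law (with `QLocalNonpos`) are JOINTLY UNSATISFIABLE. LOCATED, not
adjudicated: which normalisation the Θ-pilot's Kummer images carry is the attach point of E-LOCATION §L2 (Mochizuki2024JoshiReport (HllVl)/
(EssGlIq) ↔ [J-III] §4.5, (9.9.4)). [claim: Joshi2024ATS3, status: disputed] [claim: Mochizuki2012, status: disputed] -/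
theorem not_scaling_of_thetaSquareLaw (hM : ThetaSquareLaw P) {vQ : T.VQ} (hq : P.qLocal (Setting.labelSucc (idxTwo T)) vQ < 0)
    (hq' : QLocalNonpos P) : ¬ ThetaValuationScaling P :=
  not_scaling_of_thetaBelowQ (thetaBelowQ_of_thetaSquareLaw hM hq) hq'

/-- Dually: Joshi's reading J rules out the `j²` law (same hypotheses). [folklore] -/
theorem not_thetaSquareLaw_of_scaling (hJ : ThetaValuationScaling P) (hq' : QLocalNonpos P) {vQ : T.VQ}
    (hq : P.qLocal (Setting.labelSucc (idxTwo T)) vQ < 0) : ¬ ThetaSquareLaw P := fun hM =>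
  not_scaling_of_thetaSquareLaw hM hq hq' hJ

/-- The two laws AGREE only degenerately: if both hold in a packet at label `j = i+1` for the same Kummer image index, then
`(j² − (j/ℓ*)²)·qLocal = 0` there — so `qLocal = 0` or `j = ℓ*·j`, i.e. `ℓ* = 1` (excluded by `ℓ ≥ 5`). Recorded as the real identity.
[folklore] -/
theorem laws_agree_only_degenerately (hM : ThetaSquareLaw P) (hJ : ThetaValuationScaling P) (i : Fin T.lstar) (vQ : T.VQ) :
    (((((i : ℕ) : ℝ) + 1) ^ 2) - scalingWeight T i) * P.qLocal (Setting.labelSucc i) vQ = 0 := by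
  obtain ⟨m, hm⟩ := hJ i vQ
  have h := hM i vQ m
  rw [hm] at h
  linarith

/-! ## 3. At the cell's pinned countermodel (consistency check with p428059 / the harness) -/

section Pinned

open PinnedWitness NaiveWitness

variable (p : ℕ) [hp : Fact p.Prime]

/-- The `j²` law HOLDS at abc-iut-w4-d101's object-honest pinned countermodel (`thetaRegion m j = B_{j²}`, q-image `B_1`, volumes
`−j²·log p` and `−log p`). [folklore] -/
theorem thetaSquareLaw_pinnedSetting : ThetaSquareLaw (pinnedSetting p) := by
  intro i vQ m
  unfold Setting.qLocal
  rw [pinnedSetting_thetaRegion, pinnedSetting_qRegion_of_ne_zero p (Setting.labelSucc_ne_zero i)]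
  show pVol p _ vQ (pBall p _ vQ (jsq (Setting.labelSucc i))) = _ * pVol p _ vQ (pBall p _ vQ 1)
  rw [pVol_pBall, pVol_pBall]
  unfold jsq Setting.labelSucc
  push_cast
  simp

/-- … so J fails there by the GENERAL attach-point lemma (re-deriving p428059's `not_scaling_pinnedSetting`): label 2, `qLocal = −log p < 0`.
[folklore] -/
theorem not_scaling_pinnedSetting' : ¬ ThetaValuationScaling (pinnedSetting p) := by
  refine not_scaling_of_thetaSquareLaw (thetaSquareLaw_pinnedSetting p) (vQ := ()) ?_ (qLocalNonpos_pinnedSetting p)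
  unfold Setting.qLocal
  rw [pinnedSetting_qRegion_of_ne_zero p (Setting.labelSucc_ne_zero _)]
  show pVol p _ () (pBall p _ () 1) < 0
  rw [pVol_pBall]
  have := log_p_pos p
  push_cast
  linarith

end Pinned

end Summit.ABC.IUTFork.Joshi

end
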